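import Summits.ResolutionOfSingularities.ResolutionOfSingularities.Theorems.FrobeniusClosingSteerCleanerDescentChart
import Summits.ResolutionOfSingularities.ResolutionOfSingularities.Theorems.FrobeniusClosingSteerQuadraticStepLemmas
import Mathlib.RingTheory.Valuation.LocalSubring
import Mathlib.Algebra.CharP.Subring
import HarnessLib

/-!
# (L2) CLEANER DESCENT — part 2: `G ^ p ∈ S + x^{p·e} S′ ⇒ G ∈ S + x^e S′` across a quadratic transform

Topic: `Summits/ResolutionOfSingularities/ResolutionOfSingularities/Theorems`. Chain W4.1 (crux `Steer`,
stmt-ResolutionOfSingularities-16345), §σ2.25 F-A3 Θ1♭ packaging (`StrippedThreadTwoN`, res-D-pv-003, FILE 3),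
lemma **(L2) CLEANER DESCENT** of res-L0-w41-tri-2's TRIAGE v9 (m7): res-L0-w41-plan-1 RULINGs 58b/63. No
`Theses.*` / `Cruxes.*` import (chain build rule); no definitions.

**Statement.** `S ⊆ K` a REGULAR local subring of a field of characteristic `p`, `S′` a quadratic transform of `S`
(`IsQuadraticTransform S S'`: a localisation of a chart `S[𝔪_S/x₀]` at a prime over `𝔪_S`), `x` a generator of
`𝔪_S · S′` (the exceptional parameter; the chain clause `hspan` of `NoEternalStrippedRadicandChain`), `G ∈ S′`,
`e ≥ 0`. If `G ^ p = s + x ^ (p·e) · H` with `s ∈ S`, `H ∈ S′`, then `G = g + x ^ e · G′` with `g ∈ S`, `G′ ∈ S′`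
(`cleaner_descent` = res-D-pv-003's engine binder; `exists_eq_add_pow_mul`; generator-free
`exists_sub_mem_pow_of_pow_sub_mem_pow`; along a valuation `exists_eq_add_pow_mul_of_isQuadraticTransformAlong`). Use
(tri-2 m7): the accumulated cleaner `G ∈ S (m+1)` of a stripped block has `G ^ p ≡ f m (mod x^{pe})`, so the K♭(c)
law `f (m+1) · x ^ (p e) = f m − g ^ p` holds with `g ∈ S m` after the additive renormalisation `f ↦ c^p f + L^p`.

**Proof** (tri-2's graded argument, as an induction on `e` re-absorbing the graded pieces into `S` at every step).
With `x₀ ∈ 𝔪_S ∖ 𝔪_S²` the chart denominator, `B = S[𝔪/x₀]` presented as the image of `τ : S[T_j] → K`,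
`T_j ↦ z_j/x₀` (part 1, `FrobeniusClosingSteerCleanerDescentChart.lean`). STEP (`exists_eq_add_mul_of_pow_eq`): from
`G ^ p = y / x₀^{pe} + x₀^p · H`, `y ∈ 𝔪^{pe}`, write `y / x₀^{pe} = τ Φ` (`deg Φ ≤ pe`), `G = a/b`, `a = τ A`,
`b = τ C`, `b` a unit of `S′`; then `τ(A^p − C^p Φ) ∈ B ∩ x₀ S′ = x₀ B` (`x₀ B` is prime and misses the units of
`S′`), so `Ā^p = C̄^p Φ̄` in `κ(S)[T]` by the COEFFICIENT TEST, `Ā = C̄ W`, `W^p = Φ̄`, `p · deg W ≤ deg Φ̄ ≤ pe`;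
a lift `P_w` of `W` of degree `≤ e` gives `w = τ P_w` with `x₀^e w ∈ S` and `a − b w ∈ x₀ B`, i.e. `G = w + x₀ G′`.
INDUCTION (`exists_eq_add_pow_mul_aux`): from `G = g + x₀^e G_e`, `G^p = s + x₀^{p(e+1)} H` get
`x₀^{pe}(G_e^p − x₀^p H) = s − g^p ∈ S ∩ x₀^{pe} S′ = 𝔪^{pe}` by **Q2** (`QuadraticStep.mul_pow_mem_maximalIdeal_pow`
through a valuation ring dominating `S′`: Chevalley + `IsQuadraticTransform.along`), apply the STEP, absorb `x₀^e w`.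

Everything here is OURS (campaign res-hironaka, rung L, slot W4.1); it replaces the role of no printed item and is
NOT a statement of the manuscript under review [claim: Hironaka2017, status: under-review]. Classical background:
Zariski–Samuel II Ch. VIII §1 (order valuation of a regular local ring), Stacks 0BIQ.
-/

set_option linter.dupNamespace false

noncomputable section

open IsLocalRing MvPolynomial Literature.AlgebraicGeometry.Resolution

namespace Summit.ResolutionOfSingularities.ResolutionOfSingularities.Theorems.SwitchingDichotomy.CleanerDescent

variable {K : Type} [Field K]

section Setup

variable {S S' : Subring K} [IsRegularLocalRing S]

/-- **Chevalley + Cutkosky §2.2**: a quadratic transform `S′` of the regular local `S` is the quadratic transform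
ALONG some valuation ring `O` of `K` dominating `S′` (and `S`). [folklore] -/
theorem exists_isQuadraticTransformAlong (hq : IsQuadraticTransform S S') :
    ∃ O : ValuationSubring K, IsQuadraticTransformAlong O S S' ∧
      SubringDominates S O.toSubring ∧ SubringDominates S' O.toSubring := by
  haveI : IsLocalRing S' := hq.isLocalRing
  obtain ⟨O, hO⟩ := (LocalSubring.mk S').exists_le_valuationSubring
  haveI : IsLocalRing O.toSubring := O.toLocalSubring.isLocalRing
  have h₁ : SubringDominates S' O.toSubring := (subringDominates_iff S' O.toSubring).mpr hO
  have hfg : ∃ _ : IsLocalRing S, (maximalIdeal S).FG := ⟨inferInstance, IsNoetherian.noetherian _⟩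
  exact ⟨O, hq.along hfg h₁, hq.dominates.trans h₁, h₁⟩

/-- **Q2 across an abstract quadratic transform** of a regular local subring: for `x ∈ 𝔪_S`, `a ∈ S′` and
`xⁿ · a ∈ S` one has `xⁿ · a ∈ 𝔪_Sⁿ` (the `𝔪_S`-adic order is non-negative on `S′`;
`QuadraticStep.mul_pow_mem_maximalIdeal_pow` along a dominating valuation ring).
[cite: ZariskiSamuel1960, Ch. VIII §1 Thm. 1] [folklore] -/
theorem pow_mul_mem_maximalIdeal_pow (hq : IsQuadraticTransform S S') {x : K} (hxS : x ∈ S)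
    (hxm : (⟨x, hxS⟩ : S) ∈ maximalIdeal S) {a : K} (ha : a ∈ S') (n : ℕ) (hxa : x ^ n * a ∈ S) :
    (⟨x ^ n * a, hxa⟩ : S) ∈ maximalIdeal S ^ n := by
  obtain ⟨O, halong, hdom, -⟩ := exists_isQuadraticTransformAlong hq
  have hvx : O.valuation x < 1 :=
    ((subringDominates_valuationSubring_iff hdom.1).mp hdom ⟨x, hxS⟩).mp hxm
  exact QuadraticStep.mul_pow_mem_maximalIdeal_pow halong hdom hxS hvx ha n hxa

/-- The chart denominator of a quadratic transform of a regular local subring is a minimal generator of `𝔪_S`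
(`x₀ ∉ 𝔪_S²`): every `y ∈ 𝔪_S` has `y/x₀ ∈ S′ ⊆ O`, so `x₀` has least value. [folklore] -/
theorem not_mem_sq_of_blowupRing_le (hq : IsQuadraticTransform S S') {x₀ : S} (hx₀0 : x₀ ≠ 0)
    (hB : blowupRing S (x₀ : K) ≤ S') : x₀ ∉ maximalIdeal S ^ 2 := by
  obtain ⟨O, -, hdom, hdom'⟩ := exists_isQuadraticTransformAlong hq
  have hx₀K : (x₀ : K) ≠ 0 := fun h => hx₀0 (Subtype.ext h)
  refine QuadraticStep.not_mem_sq_of_forall_valuation_le hdom hx₀K fun y hy => ?_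
  have hyx : (y : K) / x₀ ∈ O := hdom'.1 (hB (div_mem_blowupRing _ hy))
  rw [← O.valuation_le_one_iff, map_div₀, div_le_one₀
    (pos_iff_ne_zero.mpr ((map_ne_zero _).mpr hx₀K))] at hyx
  exact hyx

omit [IsRegularLocalRing S] in
/-- A unit of `S′` is not a multiple of `x₀ ∈ 𝔪_S` inside `S′` (domination: else `x₀⁻¹ ∈ S′`, so `x₀⁻¹ ∈ S`).
[folklore] -/
theorem false_of_eq_mul_of_inv_mem [IsLocalRing S] (hdom : SubringDominates S S') {x₀ : S}
    (hx₀m : x₀ ∈ maximalIdeal S) {b : K} (hb0 : b ≠ 0) (hbinv : b⁻¹ ∈ S') {β : K} (hβ : β ∈ S')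
    (h : b = (x₀ : K) * β) : False := by
  have hx₀K : (x₀ : K) ≠ 0 := by
    rintro h0
    rw [h0, zero_mul] at h
    exact hb0 h
  have hinv : (x₀ : K)⁻¹ = β * b⁻¹ := by
    rw [h, mul_inv, ← mul_assoc, mul_comm β, mul_assoc (x₀ : K)⁻¹, mul_inv_cancel₀, mul_one]
    rintro hβ0
    rw [hβ0, mul_zero] at h
    exact hb0 h
  have hmem : (x₀ : K)⁻¹ ∈ S := hdom.2 _ x₀.2 (hinv ▸ mul_mem hβ hbinv)
  rcases (mem_maximalIdeal_iff_inv_not_mem x₀).mp hx₀m with h0 | hni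
  · exact hx₀K h0
  · exact hni hmem

/-- **`B ∩ x₀ S′ = x₀ B`** for the chart `B = S[𝔪/x₀] ⊆ S′`: the exceptional prime `x₀ B` is prime and the
denominators of `S′ = B_𝔮` are units of `S′`, hence not in `x₀ B`. [folklore] -/
theorem exists_eq_mul_of_mem_blowupRing_of_eq_mul (hq : IsQuadraticTransform S S') {x₀ : S}
    (hx₀m : x₀ ∈ maximalIdeal S) (hx₀0 : x₀ ≠ 0) (hB : blowupRing S (x₀ : K) ≤ S')
    (hfrac : ∀ w ∈ S', ∃ a ∈ blowupRing S (x₀ : K), ∃ b ∈ blowupRing S (x₀ : K), b⁻¹ ∈ S' ∧ w = a / b)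
    {β : K} (hβ : β ∈ blowupRing S (x₀ : K)) {h : K} (hh : h ∈ S') (he : β = (x₀ : K) * h) :
    ∃ β' ∈ blowupRing S (x₀ : K), β = (x₀ : K) * β' := by
  have hx₀K : (x₀ : K) ≠ 0 := fun h => hx₀0 (Subtype.ext h)
  have hprime := isPrime_span_singleton_blowupRing S x₀.2 (by simpa using hx₀m)
    (by simpa using not_mem_sq_of_blowupRing_le hq hx₀0 hB) hx₀K
  obtain ⟨a, ha, b, hb, hbinv, rfl⟩ := hfrac h hh
  by_cases hb0 : b = 0
  · exact ⟨0, Subring.zero_mem _, by rw [he, hb0, div_zero]⟩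
  -- `β · b = x₀ · a` in `B`, and `x₀ B` is prime
  have hmul : (⟨β, hβ⟩ : blowupRing S (x₀ : K)) * ⟨b, hb⟩ =
      ⟨(x₀ : K), le_blowupRing S (x₀ : K) x₀.2⟩ * ⟨a, ha⟩ := by
    apply Subtype.ext
    change β * b = (x₀ : K) * a
    rw [he, mul_assoc, div_mul_cancel₀ a hb0]
  have hmem : (⟨β, hβ⟩ : blowupRing S (x₀ : K)) * ⟨b, hb⟩ ∈
      Ideal.span {(⟨(x₀ : K), le_blowupRing S (x₀ : K) x₀.2⟩ : blowupRing S (x₀ : K))} :=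
    Ideal.mem_span_singleton'.mpr ⟨⟨a, ha⟩, by rw [hmul, mul_comm]⟩
  rcases hprime.mem_or_mem hmem with h1 | h2
  · obtain ⟨c, hc⟩ := Ideal.mem_span_singleton'.mp h1
    exact ⟨c, c.2, by have := congrArg Subtype.val hc; simpa [Subring.coe_mul, mul_comm] using this.symm⟩
  · obtain ⟨c, hc⟩ := Ideal.mem_span_singleton'.mp h2
    have hceq : b = (x₀ : K) * c := by
      have := congrArg Subtype.val hc; simpa [Subring.coe_mul, mul_comm] using this.symm
    exact (false_of_eq_mul_of_inv_mem hq.dominates hx₀m hb0 hbinv (hB c.2) hceq).elim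

end Setup

section Descent

variable (p : ℕ) [Fact p.Prime] [CharP K p] {S S' : Subring K} [IsRegularLocalRing S]

/-- **The descent step.** In the chart presentation (`z` a regular system of parameters with `x₀ = z i` the
chart denominator of the quadratic transform `S′`): if `G ∈ S′` and `G ^ p = y / x₀^{p e} + x₀ ^ p · H` with
`y ∈ 𝔪_S^{p e}`, `H ∈ S′`, then `G = w + x₀ · G′` with `x₀ ^ e · w ∈ S` and `G′ ∈ S′` (coefficient test in
`κ(S)[T]`: `p`-th roots of polynomials of degree `≤ pe` have degree `≤ e`). OURS (tri-2 TRIAGE v9 m7). [folklore] -/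
theorem exists_eq_add_mul_of_pow_eq (hq : IsQuadraticTransform S S') {d : ℕ}
    (hd : (maximalIdeal S).spanFinrank = d) (z : Fin d → S) (hz : Ideal.span (Set.range z) = maximalIdeal S)
    (i : Fin d) (hzi : z i ≠ 0) (hB : blowupRing S ((z i : S) : K) ≤ S')
    (hfrac : ∀ w ∈ S', ∃ a ∈ blowupRing S ((z i : S) : K), ∃ b ∈ blowupRing S ((z i : S) : K),
      b⁻¹ ∈ S' ∧ w = a / b)
    (e : ℕ) {G : K} (hG : G ∈ S') {y : S} (hy : y ∈ maximalIdeal S ^ (p * e)) {H : K} (hH : H ∈ S')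
    (heq : G ^ p = (y : K) / ((z i : S) : K) ^ (p * e) + ((z i : S) : K) ^ p * H) :
    ∃ w : K, ((z i : S) : K) ^ e * w ∈ S ∧ ∃ G' ∈ S', G = w + ((z i : S) : K) * G' := by
  classical
  have hp : p.Prime := Fact.out
  have hx0 : ((z i : S) : K) ≠ 0 := fun h => hzi (Subtype.ext h)
  have hzm : z i ∈ maximalIdeal S := hz ▸ Ideal.subset_span ⟨i, rfl⟩
  set x₀ : K := ((z i : S) : K) with hx₀def
  -- `y / x₀^{pe} = τ Φ` with `deg Φ ≤ pe`
  obtain ⟨Φ, hdegΦ, hΦ⟩ := exists_eval₂Hom_eq_div_pow_of_mem_pow S z i hz hzi (p * e) y hy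
  -- `G = a / b`
  obtain ⟨a, ha, b, hb, hbinv, hGab⟩ := hfrac G hG
  by_cases hb0 : b = 0
  · refine ⟨0, by rw [mul_zero]; exact S.zero_mem, 0, S'.zero_mem, ?_⟩
    rw [hGab, hb0, div_zero, mul_zero, add_zero]
  obtain ⟨A, hA⟩ := exists_eval₂Hom_eq_of_mem_blowupRing S z i hz hzi ha
  obtain ⟨C, hC⟩ := exists_eval₂Hom_eq_of_mem_blowupRing S z i hz hzi hb
  -- `b` is a unit of `S′`, so `C ∉ 𝔪 · S[T]`
  have hCne : MvPolynomial.map (residue S) C ≠ 0 := by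
    intro h0
    obtain ⟨β, hβ, hβeq⟩ := exists_eval₂Hom_eq_mul_of_coeff_mem S z i hd hz hzi C
      ((map_residue_eq_zero_iff C).mp h0)
    rw [hC] at hβeq
    exact false_of_eq_mul_of_inv_mem hq.dominates hzm hb0 hbinv (hB hβ) hβeq
  -- the relation `a^p − b^p · τ Φ = x₀ · (x₀^{p-1} b^p H)` lies in `B ∩ x₀ S′ = x₀ B`
  have haG : a = G * b := by rw [hGab, div_mul_cancel₀ a hb0]
  have hrel : MvPolynomial.eval₂Hom S.subtype
      (fun j : {j : Fin d // j ≠ i} => ((z j.1 : S) : K) / ((z i : S) : K)) (A ^ p - C ^ p * Φ) =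
        x₀ * (x₀ ^ (p - 1) * b ^ p * H) := by
    rw [map_sub, map_mul, map_pow, map_pow, hA, hC, hΦ, haG, mul_pow, heq]
    have hp1 : x₀ ^ p = x₀ * x₀ ^ (p - 1) := by
      rw [← pow_succ', Nat.sub_add_cancel hp.one_le]
    rw [hp1]
    ring
  obtain ⟨β, hβ, hβeq⟩ := exists_eq_mul_of_mem_blowupRing_of_eq_mul hq hzm hzi hB hfrac
    (eval₂Hom_mem_blowupRing S z i hz (A ^ p - C ^ p * Φ))
    (mul_mem (mul_mem (pow_mem (hB (le_blowupRing S x₀ (z i).2)) _) (pow_mem (hB hb) p)) hH) hrel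
  have hcoeff := coeff_mem_maximalIdeal_of_eval₂Hom_eq_mul S z i hd hz hzi (A ^ p - C ^ p * Φ) hβ hβeq
  -- in `κ(S)[T]`: `Ā^p = C̄^p · Φ̄`, so `Ā = C̄ · W`, `W^p = Φ̄`, `deg W ≤ e`
  have hres : (MvPolynomial.map (residue S) A) ^ p =
      (MvPolynomial.map (residue S) C) ^ p * MvPolynomial.map (residue S) Φ := by
    have h0 := (map_residue_eq_zero_iff (A ^ p - C ^ p * Φ)).mpr hcoeff
    rw [map_sub, map_mul, map_pow, map_pow, sub_eq_zero] at h0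
    exact h0
  obtain ⟨W, hW, hWp⟩ := exists_eq_mul_of_pow_eq_pow_mul hp.ne_zero hCne hres
  haveI : CharP (ResidueField S) p := by
    rw [CharP.charP_iff_prime_eq_zero hp]
    have h := map_natCast (residue S) p
    rw [CharP.cast_eq_zero, map_zero] at h
    exact h.symm
  have hdegW : W.totalDegree ≤ e := by
    have h1 := mul_totalDegree_le_totalDegree_pow p W
    rw [hWp] at h1
    exact Nat.le_of_mul_le_mul_left (h1.trans ((totalDegree_map_le _ Φ).trans hdegΦ)) hp.pos
  -- lift `W` to `P_w` of degree `≤ e`; `w := τ P_w`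
  obtain ⟨Pw, hPw, hdegPw⟩ := exists_map_residue_eq_of_totalDegree W
  set w : K := MvPolynomial.eval₂Hom S.subtype
    (fun j : {j : Fin d // j ≠ i} => ((z j.1 : S) : K) / ((z i : S) : K)) Pw with hwdef
  have hwS : x₀ ^ e * w ∈ S := pow_mul_eval₂Hom_mem_of_totalDegree_le S z i hzi Pw (hdegPw.trans hdegW)
  -- `a − b w ∈ x₀ B`
  have hcoeff2 : ∀ m, (A - C * Pw).coeff m ∈ maximalIdeal S := by
    rw [← map_residue_eq_zero_iff, map_sub, map_mul, hPw, hW, sub_self]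
  obtain ⟨γ, hγ, hγeq⟩ := exists_eval₂Hom_eq_mul_of_coeff_mem S z i hd hz hzi (A - C * Pw) hcoeff2
  rw [map_sub, map_mul, hA, hC] at hγeq
  refine ⟨w, hwS, γ * b⁻¹, mul_mem (hB hγ) hbinv, ?_⟩
  have ha' : a = b * w + x₀ * γ := by rw [← hγeq, ← hwdef]; ring
  rw [hGab, ha', add_div, mul_div_cancel_left₀ _ hb0, div_eq_mul_inv, mul_assoc]

/-- **The induction on `e`** (chart form): `G ∈ S′`, `G ^ p = s + x₀^{p e} · H` ⇒ `G = g + x₀^e · G′`.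
OURS (tri-2 TRIAGE v9 m7). [folklore] -/
theorem exists_eq_add_pow_mul_aux (hq : IsQuadraticTransform S S') {d : ℕ}
    (hd : (maximalIdeal S).spanFinrank = d) (z : Fin d → S) (hz : Ideal.span (Set.range z) = maximalIdeal S)
    (i : Fin d) (hzi : z i ≠ 0) (hB : blowupRing S ((z i : S) : K) ≤ S')
    (hfrac : ∀ w ∈ S', ∃ a ∈ blowupRing S ((z i : S) : K), ∃ b ∈ blowupRing S ((z i : S) : K),
      b⁻¹ ∈ S' ∧ w = a / b) :
    ∀ (e : ℕ) {G : K}, G ∈ S' →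
      (∃ s ∈ S, ∃ H ∈ S', G ^ p = s + ((z i : S) : K) ^ (p * e) * H) →
        ∃ g ∈ S, ∃ G' ∈ S', G = g + ((z i : S) : K) ^ e * G' := by
  have hx0 : ((z i : S) : K) ≠ 0 := fun h => hzi (Subtype.ext h)
  have hzm : z i ∈ maximalIdeal S := hz ▸ Ideal.subset_span ⟨i, rfl⟩
  have hx₀S' : ((z i : S) : K) ∈ S' := hB (le_blowupRing S _ (z i).2)
  intro e
  induction e with
  | zero =>
    intro G hG _
    exact ⟨0, S.zero_mem, G, hG, by rw [pow_zero, one_mul, zero_add]⟩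
  | succ e ih =>
    intro G hG hGp
    obtain ⟨s, hs, H, hH, hGp⟩ := hGp
    have h' : ∃ s ∈ S, ∃ H' ∈ S', G ^ p = s + ((z i : S) : K) ^ (p * e) * H' :=
      ⟨s, hs, ((z i : S) : K) ^ p * H, mul_mem (pow_mem hx₀S' p) hH, by rw [hGp]; ring⟩
    obtain ⟨g, hg, Ge, hGe, hGeq⟩ := ih hG h'
    -- `x₀^{pe} (Ge^p − x₀^p H) = s − g^p ∈ S`, hence `∈ 𝔪^{pe}` by Q2
    have hkey : ((z i : S) : K) ^ (p * e) * (Ge ^ p - ((z i : S) : K) ^ p * H) = s - g ^ p := by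
      have h2 : G ^ p = g ^ p + ((z i : S) : K) ^ (p * e) * Ge ^ p := by
        rw [hGeq, add_pow_char, mul_pow, ← pow_mul, mul_comm e p]
      linear_combination hGp - h2
    have hya : ((z i : S) : K) ^ (p * e) * (Ge ^ p - ((z i : S) : K) ^ p * H) ∈ S := by
      rw [hkey]
      exact sub_mem hs (pow_mem hg p)
    have hy := pow_mul_mem_maximalIdeal_pow hq (z i).2 (by simpa using hzm)
      (sub_mem (pow_mem hGe p) (mul_mem (pow_mem hx₀S' p) hH)) (p * e) hya
    have heq : Ge ^ p = (((⟨_, hya⟩ : S) : S) : K) / ((z i : S) : K) ^ (p * e) + ((z i : S) : K) ^ p * H := by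
      change Ge ^ p = ((z i : S) : K) ^ (p * e) * (Ge ^ p - ((z i : S) : K) ^ p * H) / _ + _
      rw [mul_div_cancel_left₀ _ (pow_ne_zero _ hx0), sub_add_cancel]
    obtain ⟨w, hw, G', hG', hGe'⟩ := exists_eq_add_mul_of_pow_eq p hq hd z hz i hzi hB hfrac e hGe hy hH heq
    refine ⟨g + ((z i : S) : K) ^ e * w, add_mem hg hw, G', hG', ?_⟩
    rw [hGeq, hGe', pow_succ]
    ring

end Descent

section Forms

variable (p : ℕ) [Fact p.Prime] [CharP K p] {S S' : Subring K} [IsRegularLocalRing S]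

/-- **(L2) CLEANER DESCENT, chart form.** For a quadratic transform `S′` of the regular local `S ⊆ K`
(characteristic `p`) there is a chart denominator `x₀ ∈ 𝔪_S`, `x₀ ≠ 0`, with `S[𝔪_S/x₀] ⊆ S′`, such that for
every `e` and `G ∈ S′`: `G ^ p ∈ S + x₀^{p e} S′ ⇒ G ∈ S + x₀^e S′`. OURS (tri-2 TRIAGE v9 m7). [folklore] -/
theorem exists_chart_forall_exists_eq_add_pow_mul (hq : IsQuadraticTransform S S') :
    ∃ x₀ : S, x₀ ∈ maximalIdeal S ∧ x₀ ≠ 0 ∧ blowupRing S (x₀ : K) ≤ S' ∧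
      ∀ (e : ℕ) {G : K}, G ∈ S' → (∃ s ∈ S, ∃ H ∈ S', G ^ p = s + (x₀ : K) ^ (p * e) * H) →
        ∃ g ∈ S, ∃ G' ∈ S', G = g + (x₀ : K) ^ e * G' := by
  classical
  have hq' := hq
  obtain ⟨_, x₀, hx₀m, hx₀0, _, hB, hfrac, -⟩ := hq'
  have hx₀K : (x₀ : K) ≠ 0 := fun h => hx₀0 (Subtype.ext h)
  have hx2 : x₀ ∉ maximalIdeal S ^ 2 := not_mem_sq_of_blowupRing_le hq hx₀0 hB
  -- extend `x₀` to a regular system of parameters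
  have hd0 : 0 < (maximalIdeal S).spanFinrank := by
    by_contra h0
    have h0' : (maximalIdeal S).spanFinrank = 0 := Nat.eq_zero_of_not_pos h0
    have hgen := (IsNoetherian.noetherian (maximalIdeal S)).generators_ncard
    rw [h0', Set.ncard_eq_zero (Submodule.FG.finite_generators (IsNoetherian.noetherian _))] at hgen
    have hspan := Submodule.span_generators (maximalIdeal S : Submodule S S)
    rw [hgen, Submodule.span_empty] at hspan
    exact hx₀0 ((Submodule.mem_bot S).mp (hspan ▸ hx₀m))
  obtain ⟨z, hz, hzj⟩ := exists_rsop_apply_eq rfl hx₀m hx2 ⟨0, hd0⟩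
  subst hzj
  exact ⟨z ⟨0, hd0⟩, hx₀m, hx₀0, hB, exists_eq_add_pow_mul_aux p hq rfl z hz ⟨0, hd0⟩ hx₀0 hB hfrac⟩

/-- **(L2) CLEANER DESCENT — chain form** (the binder shapes of `NoEternalStrippedRadicandChain`: `S ≤ S′`,
`IsQuadraticTransform S S′`, the exceptional parameter `x : S′` through `hspan : 𝔪_S · S′ = (x)`): if `G ∈ S′`
and `G ^ p = s + x ^ (p·e) · H` with `s ∈ S`, `H ∈ S′`, then `G = g + x ^ e · G′` with `g ∈ S`, `G′ ∈ S′`.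
OURS (res-L0-w41-tri-2 TRIAGE v9 (m7) lemma (L2); consumer: res-D-pv-003's Θ1♭ FILE 3). [folklore] -/
theorem exists_eq_add_pow_mul (hle : S ≤ S') (hq : IsQuadraticTransform S S') (x : S')
    (hspan : Ideal.span ((fun y : S => (⟨(y : K), hle y.2⟩ : S')) '' (maximalIdeal S : Set S))
      = Ideal.span {x})
    (e : ℕ) {G s H : K} (hG : G ∈ S') (hs : s ∈ S) (hH : H ∈ S')
    (hlaw : G ^ p = s + (x : K) ^ (p * e) * H) :
    ∃ g ∈ S, ∃ H' ∈ S', G = g + (x : K) ^ e * H' := by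
  obtain ⟨x₀, hx₀m, hx₀0, hB, hcore⟩ := exists_chart_forall_exists_eq_add_pow_mul p hq
  -- `x₀ = c · x` and `x = c′ · x₀` in `S′`
  have hx₀mem : (⟨(x₀ : K), hle x₀.2⟩ : S') ∈ Ideal.span {x} :=
    hspan ▸ Ideal.subset_span ⟨x₀, hx₀m, rfl⟩
  obtain ⟨c, hc⟩ := Ideal.mem_span_singleton'.mp hx₀mem
  have hcK : (x₀ : K) = (c : K) * (x : K) := by
    have := congrArg Subtype.val hc; simpa [Subring.coe_mul] using this.symm
  have hle' : Ideal.span ((fun y : S => (⟨(y : K), hle y.2⟩ : S')) '' (maximalIdeal S : Set S)) ≤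
      Ideal.span {(⟨(x₀ : K), hle x₀.2⟩ : S')} := by
    refine Ideal.span_le.mpr ?_
    rintro _ ⟨y, hy, rfl⟩
    refine Ideal.mem_span_singleton'.mpr ⟨⟨(y : K) / x₀, hB (div_mem_blowupRing _ hy)⟩, Subtype.ext ?_⟩
    change (y : K) / x₀ * x₀ = y
    exact div_mul_cancel₀ _ fun h => hx₀0 (Subtype.ext h)
  have hxmem : x ∈ Ideal.span {(⟨(x₀ : K), hle x₀.2⟩ : S')} :=
    hle' (hspan ▸ Ideal.mem_span_singleton_self x)
  obtain ⟨c', hc'⟩ := Ideal.mem_span_singleton'.mp hxmem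
  have hc'K : (x : K) = (c' : K) * (x₀ : K) := by
    have := congrArg Subtype.val hc'; simpa [Subring.coe_mul] using this.symm
  -- run the chart form
  have hyp : ∃ s ∈ S, ∃ H' ∈ S', G ^ p = s + (x₀ : K) ^ (p * e) * H' := by
    refine ⟨s, hs, (c' : K) ^ (p * e) * H, mul_mem (pow_mem c'.2 _) hH, ?_⟩
    rw [hlaw, hc'K, mul_pow]
    ring
  obtain ⟨g, hg, G', hG', hGeq⟩ := hcore e hG hyp
  refine ⟨g, hg, (c : K) ^ e * G', mul_mem (pow_mem c.2 e) hG', ?_⟩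
  rw [hGeq, hcK, mul_pow]
  ring

/-- **(L2) CLEANER DESCENT — Θ1♭ ENGINE FORM** (res-D-pv-003's binder shape 10:20:38Z, VERBATIM: the K♭(c) chain clauses
`IsQuadraticTransform (S m) (S (m+1))` and `hspan` with `x m := ⟨ξ, hξ⟩`, the law read in `K` with membership hypotheses):
`f − G ^ p = ξ ^ (p·e) · F` with `f ∈ S`, `G, F ∈ S′` ⇒ `G = g + ξ ^ e · h`, `g ∈ S`, `h ∈ S′`. (`1 ≤ e` and the
regularity of `S′` are not used.) OURS; consumer: the Θ1♭ engine `not_noEternalStrippedChain_of_thread` (binder `hCD`).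
[folklore] -/
theorem cleaner_descent [IsRegularLocalRing S'] (hle : S ≤ S') (hqt : IsQuadraticTransform S S')
    {ξ : K} (hξ : ξ ∈ S')
    (hspan : Ideal.span ((fun y : S => (⟨(y : K), hle y.2⟩ : S')) '' (IsLocalRing.maximalIdeal S : Set S))
      = Ideal.span {(⟨ξ, hξ⟩ : S')})
    {f G F : K} (hf : f ∈ S) (hG : G ∈ S') (hF : F ∈ S') {e : ℕ} (_he : 1 ≤ e)
    (hlaw : f - G ^ p = ξ ^ (p * e) * F) :
    ∃ g h : K, g ∈ S ∧ h ∈ S' ∧ G = g + ξ ^ e * h := by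
  have hlaw' : G ^ p = f + ((⟨ξ, hξ⟩ : S') : K) ^ (p * e) * (-F) := by
    change G ^ p = f + ξ ^ (p * e) * (-F)
    linear_combination -hlaw
  obtain ⟨g, hg, h, hh, hGeq⟩ := exists_eq_add_pow_mul p hle hqt ⟨ξ, hξ⟩ hspan e hG hf (neg_mem hF) hlaw'
  exact ⟨g, h, hg, hh, hGeq⟩

/-- **(L2) CLEANER DESCENT — generator-free form**: with `𝔪′ := 𝔪_S · S′` (the exceptional ideal of the quadratic
transform), `G ^ p − s ∈ 𝔪′^{p e}` for some `s ∈ S` implies `G − g ∈ 𝔪′^e` for some `g ∈ S`. OURS. [folklore] -/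
theorem exists_sub_mem_pow_of_pow_sub_mem_pow (hle : S ≤ S') (hq : IsQuadraticTransform S S') (e : ℕ)
    (G : S') (s : S)
    (h : G ^ p - Subring.inclusion hle s ∈ (Ideal.map (Subring.inclusion hle) (maximalIdeal S)) ^ (p * e)) :
    ∃ g : S, G - Subring.inclusion hle g ∈ (Ideal.map (Subring.inclusion hle) (maximalIdeal S)) ^ e := by
  obtain ⟨x₀, hx₀m, hx₀0, hB, hcore⟩ := exists_chart_forall_exists_eq_add_pow_mul p hq
  -- `𝔪_S · S′ = (x₀)`
  have hmap : Ideal.map (Subring.inclusion hle) (maximalIdeal S) = Ideal.span {Subring.inclusion hle x₀} := by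
    apply le_antisymm
    · refine Ideal.map_le_iff_le_comap.mpr fun y hy => ?_
      refine Ideal.mem_span_singleton'.mpr ⟨⟨(y : K) / x₀, hB (div_mem_blowupRing _ hy)⟩, Subtype.ext ?_⟩
      change (y : K) / x₀ * x₀ = y
      exact div_mul_cancel₀ _ fun h => hx₀0 (Subtype.ext h)
    · exact (Ideal.span_singleton_le_iff_mem _).mpr (Ideal.mem_map_of_mem _ hx₀m)
  rw [hmap, Ideal.span_singleton_pow] at h ⊢
  obtain ⟨c, hc⟩ := Ideal.mem_span_singleton'.mp h
  have hyp : ∃ s ∈ S, ∃ H' ∈ S', (G : K) ^ p = s + (x₀ : K) ^ (p * e) * H' := by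
    refine ⟨s, s.2, c, c.2, ?_⟩
    have := congrArg Subtype.val hc
    simp only [Subring.coe_mul, SubmonoidClass.coe_pow, Subring.coe_inclusion,
      AddSubgroupClass.coe_sub] at this
    linear_combination -this
  obtain ⟨g, hg, G', hG', hGeq⟩ := hcore e G.2 hyp
  refine ⟨⟨g, hg⟩, Ideal.mem_span_singleton'.mpr ⟨⟨G', hG'⟩, Subtype.ext ?_⟩⟩
  simp only [Subring.coe_mul, SubmonoidClass.coe_pow, Subring.coe_inclusion, AddSubgroupClass.coe_sub]
  rw [hGeq]
  ring

/-- **(L2) CLEANER DESCENT — along a valuation**: the same for the quadratic transform `S′` of `S` ALONG `O`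
(`IsQuadraticTransformAlong O S S′` with `S` dominated by `O` — the `locAtCentre (blowupRing S ξ) O` form of
the steered runs), via `IsQuadraticTransformAlong.isQuadraticTransform`. OURS. [folklore] -/
theorem exists_eq_add_pow_mul_of_isQuadraticTransformAlong {O : ValuationSubring K} (hle : S ≤ S')
    (hq : IsQuadraticTransformAlong O S S') (hO : SubringDominates S O.toSubring) (x : S')
    (hspan : Ideal.span ((fun y : S => (⟨(y : K), hle y.2⟩ : S')) '' (maximalIdeal S : Set S))
      = Ideal.span {x})
    (e : ℕ) {G s H : K} (hG : G ∈ S') (hs : s ∈ S) (hH : H ∈ S')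
    (hlaw : G ^ p = s + (x : K) ^ (p * e) * H) :
    ∃ g ∈ S, ∃ H' ∈ S', G = g + (x : K) ^ e * H' :=
  exists_eq_add_pow_mul p hle (hq.isQuadraticTransform hO) x hspan e hG hs hH hlaw

end Forms

end Summit.ResolutionOfSingularities.ResolutionOfSingularities.Theorems.SwitchingDichotomy.CleanerDescent

end
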